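import Summits.HodgeConjecture.HodgeConjecture.Theorems.F0P2cOmegaLocalType   -- ★ p803803: `formCongr_frame` (the frame congruence `κ_v`)
import Literature.NumberTheory.Automorphic.UnitaryGroupDualPairLocalLine       -- ★ `localLineInl`, `localLineGL`
import Literature.NumberTheory.Automorphic.UnitaryGroupSplitPlace              -- ★ `localPiSplitEquiv`
import Literature.NumberTheory.Automorphic.Liu2021.LemD1AsPrinted              -- ★ `AreIsomorphicRep`
import Mathlib.LinearAlgebra.Matrix.Permutation
import HarnessLib

/-!
# FLOOR-0 P2 — PKΠ RUNG 4, row GRD-(S), TRANSPORT: at a split place, `X ∘ localLineInl ∘ κ_v⁻¹` on `U(H)(L⁺_v)` is the split model of `X`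
# pulled back along `localPiSplitEquiv H`, for EVERY representation `X` of `U(J)(L⁺_v)`, `J = reindex e₁ (diag dV ⊗ J_W)`

Cell hodgecm-mathlib (D-0151), FLOOR 0, programme P2 (theta ∕ `hdictE`); crux item H413 = stmt-HodgeConjecture-24833 (`HCCMUnconditional.H413`);
sub-line `Cruxes/H413/Lines/F0_P2PKPiRung4.lean` (F0P2-plan (g6), DESIGN LOCKED 2026-08-31T08:15:17Z), row GRD-(S) dealt to F0P2-p01 (g5) (prover
census `F0/P2/CENSUS-LTY-DICTsplit.F0P2p01g5.md` §B (m1)).  THEOREMS ONLY (no `def`, no instance, no notation, no named fact, no `sorry`); never imports a `Cruxes/…/Lines` module; `--supports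
stmt-HodgeConjecture-24833 --as helper`.  HC_CM is proved only modulo the printed citations until rung 0 closes; this file discharges none.

THE BOOKKEEPING (m1) OF DICT_split ∕ GRD-(S).  Data: CM field `L`, frame `ᵗ(c̄ g) H g = diag dV` with its local congruence `κ_v : U(diag dV)(L⁺_v) ≃
U(H)(L⁺_v)`, `u ↦ g_v u g_v⁻¹` (★ `localCongr`, ★ `formCongr_frame`), an enumeration `e₁ : Fin 3 × Fin 1 ≃ Fin n'`, a hermitian line `J_W`, the doubled
form `J = reindex e₁ (diag dV ⊗ J_W)` with its line embedding `localLineInl : U(diag dV)(L⁺_v) → U(J)(L⁺_v)`, `k ↦ reindex e₁ (k ⊗ 1)` (★), a place `v`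
of `L⁺` SPLIT in `L`, `w ∣ v` with `c̄ • w ≠ w`, and the projections `localPiSplitEquiv J : U(J)(L⁺_v) ≃ GL_{n'}(L_w)`, `localPiSplitEquiv H :
U(H)(L⁺_v) ≃ GL₃(L_w)` (★ `u ↦ u_w`).
* §1 `coe_localCongr_symm_apply_apply` — `(κ_v⁻¹ u)_w = g_w⁻¹ u_w g_w`; `localPiSplitEquiv_localLineInl_localCongr_symm` — the `w`-component of
  `localLineInl (κ_v⁻¹ u)` is `reindexGL e₁ ((g_w⁻¹ u_w g_w) ⊗ 1)`.
* §2 **`comp_localLineInl_comp_localCongr_symm_eq`** — for EVERY monoid-valued `X` on `U(J)(L⁺_v)`: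
  `X ∘ localLineInl ∘ κ_v⁻¹ = (X ∘ (localPiSplitEquiv J)⁻¹) ∘ Θ_w ∘ localPiSplitEquiv H` with `Θ_w a = reindexGL e₁ ((g_w⁻¹ a g_w) ⊗ 1)`.
* §3 `exists_theta_eq_conj` — for `n' = 3`, `Θ_w` is INNER (`reindex e (a ⊗ 1) = P a P⁻¹` for the permutation matrix `P` of `e`; Mathlib `PEquiv.toMatrix`).
* §4 generic: `nonempty_equiv_comp` (pull back a `Representation.Equiv` along a homomorphism), `nonempty_equiv_comp_conj` (`ρ ∘ Ad(h) ≃ ρ` via `ρ(h⁻¹)`),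
  `nonempty_equiv_of_areIsomorphicRep` (★ `AreIsomorphicRep` ⇒ Mathlib `Representation.Equiv`).
* §5 **`nonempty_equiv_comp_localLineInl_localCongr_symm`** (`n' = 3`) — if `X ∘ (localPiSplitEquiv J)⁻¹ ≃ I` as representations of `GL₃(L_w)` (the shape
  of ★ `Liu2021.splitPlace_chiCoinv_iso_parabolicIndGL_localSplittingCM`, p816652), then **`X ∘ localLineInl ∘ κ_v⁻¹ ≃ I ∘ localPiSplitEquiv H`** as
  representations of `U(H)(L⁺_v)`.  With `X :=` Liu's `χ_W`-coinvariants at the line and `I := Ind_{Q_{2,1}}^{GL₃(L_w)}((μ_w ∘ det₂) ⊠ χ′ μ_w⁻²)` this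
  reads «`X_v(μ, ε, χ) ∘ κ_v⁻¹` IS the split member `i_G(ξ_w) ∘ cmSplitEquiv` of Rogawski's packet once the two Levi characters agree» — the dictionary row
  at a split place, [Rogawski1990 Lemma 4.13.1 (b)] ∕ [GelbartRogawski1991 (5.1.1)].

## References
* [Rogawski1990] J. Rogawski, Ann. of Math. Stud. 123 (1990): Lemma 4.13.1 (b), §13.3 p. 201, §14.2 p. 232 (`G′_v ≅ G_v` at finite `v`).
* [GelbartRogawski1991] S. Gelbart, J. Rogawski, Invent. Math. 105 (1991): §3.2 p. 457 (`a : U(V) → G₁`), (5.1.1) p. 465.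
* [PlatonovRapinchuk1994] V. Platonov, A. Rapinchuk (1994): §2.3, §5.1 (transport of unitary groups along a frame).
* [MoeglinVignerasWaldspurger1987] LNM 1291: Chap. 1 I.17 (`k ↦ k ⊗ 1`).  [BushnellHenniart2006] §1.1 (inner twists).
-/

set_option autoImplicit false
-- the mandated namespace has the single-problem summit's repeated segment (`HodgeConjecture.HodgeConjecture`)
set_option linter.dupNamespace false

noncomputable section

open scoped Matrix Kronecker
open NumberField IsDedekindDomain
open Literature.NumberTheory Literature.NumberTheory.Automorphic Literature.NumberTheory.Automorphic.UnitaryGroup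

namespace Summit.HodgeConjecture.HodgeConjecture.Cruxes.H413.F0P2iGRDSplitTransport

/-! ## §1 The `w`-component of `localLineInl (κ_v⁻¹ u)` -/


variable (L : Type) [Field L] [NumberField L] [IsCMField L] (H : Matrix (Fin 3) (Fin 3) L) (dV : Fin 3 → L) (g : GL (Fin 3) L)
  (hg : ((g : Matrix (Fin 3) (Fin 3) L).map (cmConjRingHom L))ᵀ * H * (g : Matrix (Fin 3) (Fin 3) L) = Matrix.diagonal dV)

/-- **`(κ_v⁻¹ u)_w = g_w⁻¹ u_w g_w`** (★ `coe_localCongr_apply_apply` at `κ_v (κ_v⁻¹ u) = u`). [cite: PlatonovRapinchuk1994, §2.3] -/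
theorem coe_localCongr_symm_apply_apply (v : HeightOneSpectrum (𝓞 ↥(maximalRealSubfield L)))
    (u : localPi L (IsCMField.complexConj L) 3 H v) (w : PlacesOver L v) :
    (((localCongr L (IsCMField.complexConj L) g one_ne_zero
        (Summit.HodgeConjecture.HodgeConjecture.Cruxes.H413.F0P2cOmegaLocalType.formCongr_frame L H dV g hg) v).symm u :
        localPi L (IsCMField.complexConj L) 3 (Matrix.diagonal dV) v) : LocalGLPi L 3 v) w =
      (Matrix.GeneralLinearGroup.map (algebraMap L (w.1.adicCompletion L)) g)⁻¹ * (u : LocalGLPi L 3 v) w *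
        Matrix.GeneralLinearGroup.map (algebraMap L (w.1.adicCompletion L)) g := by
  set κ := localCongr L (IsCMField.complexConj L) g one_ne_zero
    (Summit.HodgeConjecture.HodgeConjecture.Cruxes.H413.F0P2cOmegaLocalType.formCongr_frame L H dV g hg) v with hκ
  have h := coe_localCongr_apply_apply L (IsCMField.complexConj L) g one_ne_zero
    (Summit.HodgeConjecture.HodgeConjecture.Cruxes.H413.F0P2cOmegaLocalType.formCongr_frame L H dV g hg) v (κ.symm u) w
  rw [ContinuousMulEquiv.apply_symm_apply] at h
  rw [h]
  group

/-- **the `w`-component of `localLineInl (κ_v⁻¹ u)` is `reindexGL e₁ ((g_w⁻¹ u_w g_w) ⊗ 1)`** (★ `coe_localLineInl`, ★ `localLineGL`, `coe_localCongr_symm_apply_apply`).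
[cite: MoeglinVignerasWaldspurger1987, Chap. 1 I.17] [cite: PlatonovRapinchuk1994, §2.3] -/
theorem localPiSplitEquiv_localLineInl_localCongr_symm {n' : ℕ} (e₁ : Fin 3 × Fin 1 ≃ Fin n') (JW : Matrix (Fin 1) (Fin 1) L)
    (v : HeightOneSpectrum (𝓞 ↥(maximalRealSubfield L))) (w : PlacesOver L v)
    (hw : IsCMField.complexConj L • w.1 ≠ w.1) (hc1 : IsCMField.complexConj L ≠ 1)
    (hJh : ((Matrix.reindex e₁ e₁ (Matrix.diagonal dV ⊗ₖ JW)).map (IsCMField.complexConj L))ᵀ =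
      Matrix.reindex e₁ e₁ (Matrix.diagonal dV ⊗ₖ JW))
    (hJw : IsUnit (placeForm (Matrix.reindex e₁ e₁ (Matrix.diagonal dV ⊗ₖ JW)) w.1))
    (u : localPi L (IsCMField.complexConj L) 3 H v) :
    localPiSplitEquiv (IsCMField.complexConj L) (Matrix.reindex e₁ e₁ (Matrix.diagonal dV ⊗ₖ JW)) hc1 hJh w hw hJw
        (localLineInl L (IsCMField.complexConj L) 3 e₁ (Matrix.diagonal dV) JW v
          ((localCongr L (IsCMField.complexConj L) g one_ne_zero
            (Summit.HodgeConjecture.HodgeConjecture.Cruxes.H413.F0P2cOmegaLocalType.formCongr_frame L H dV g hg) v).symm u)) =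
      UnitaryGroup.reindexGL e₁ (kroneckerGL
        ((Matrix.GeneralLinearGroup.map (algebraMap L (w.1.adicCompletion L)) g)⁻¹ * (u : LocalGLPi L 3 v) w *
          Matrix.GeneralLinearGroup.map (algebraMap L (w.1.adicCompletion L)) g, 1)) := by
  rw [localPiSplitEquiv_apply, coe_localLineInl,
    show ∀ k : LocalGLPi L 3 v, localLineGL L 3 e₁ v k w = UnitaryGroup.reindexGL e₁ (kroneckerGL (k w, 1)) from fun _ => rfl,
    coe_localCongr_symm_apply_apply L H dV g hg v u w]

/-! ## §2 `X ∘ localLineInl ∘ κ_v⁻¹` through `GL(L_w)` -/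

/-- **`X ∘ localLineInl ∘ κ_v⁻¹` on `U(H)(L⁺_v)` IS `(X ∘ (localPiSplitEquiv J)⁻¹) ∘ Θ_w ∘ localPiSplitEquiv H`** for EVERY monoid-valued `X` on
`U(J)(L⁺_v)`, `J = reindex e₁ (diag dV ⊗ J_W)`, where `Θ_w a = reindexGL e₁ ((g_w⁻¹ a g_w) ⊗ 1)` (spelled `reindexGL e₁ ∘ kroneckerGL ∘ (id, 1) ∘ Ad(g_w⁻¹)`):
both sides send `u` to `X` of the same element of `U(J)(L⁺_v)` (§1; `localPiSplitEquiv J` is a bijection). [cite: GelbartRogawski1991, §3.2 p. 457]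
[cite: Rogawski1990, §14.2 p. 232] -/
theorem comp_localLineInl_comp_localCongr_symm_eq {n' : ℕ} (e₁ : Fin 3 × Fin 1 ≃ Fin n') (JW : Matrix (Fin 1) (Fin 1) L)
    (v : HeightOneSpectrum (𝓞 ↥(maximalRealSubfield L))) (w : PlacesOver L v)
    (hw : IsCMField.complexConj L • w.1 ≠ w.1) (hc1 : IsCMField.complexConj L ≠ 1)
    (hHh : (H.map (IsCMField.complexConj L))ᵀ = H) (hHw : IsUnit (placeForm H w.1))
    (hJh : ((Matrix.reindex e₁ e₁ (Matrix.diagonal dV ⊗ₖ JW)).map (IsCMField.complexConj L))ᵀ =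
      Matrix.reindex e₁ e₁ (Matrix.diagonal dV ⊗ₖ JW))
    (hJw : IsUnit (placeForm (Matrix.reindex e₁ e₁ (Matrix.diagonal dV ⊗ₖ JW)) w.1))
    {M : Type*} [Monoid M] (X : localPi L (IsCMField.complexConj L) n' (Matrix.reindex e₁ e₁ (Matrix.diagonal dV ⊗ₖ JW)) v →* M) :
    (X.comp (localLineInl L (IsCMField.complexConj L) 3 e₁ (Matrix.diagonal dV) JW v)).comp
        (localCongr L (IsCMField.complexConj L) g one_ne_zero
          (Summit.HodgeConjecture.HodgeConjecture.Cruxes.H413.F0P2cOmegaLocalType.formCongr_frame L H dV g hg) v).symm.toMonoidHom =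
      ((X.comp (localPiSplitEquiv (IsCMField.complexConj L) (Matrix.reindex e₁ e₁ (Matrix.diagonal dV ⊗ₖ JW)) hc1 hJh w hw
          hJw).symm.toMonoidHom).comp
        (((UnitaryGroup.reindexGL e₁).comp (kroneckerGL.comp ((MonoidHom.id (GL (Fin 3) (w.1.adicCompletion L))).prod 1))).comp
          (MulAut.conj (Matrix.GeneralLinearGroup.map (algebraMap L (w.1.adicCompletion L)) g)⁻¹).toMonoidHom)).comp
        (localPiSplitEquiv (IsCMField.complexConj L) H hc1 hHh w hw hHw).toMonoidHom := by
  refine MonoidHom.ext fun u => ?_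
  show X (localLineInl L (IsCMField.complexConj L) 3 e₁ (Matrix.diagonal dV) JW v
      ((localCongr L (IsCMField.complexConj L) g one_ne_zero
        (Summit.HodgeConjecture.HodgeConjecture.Cruxes.H413.F0P2cOmegaLocalType.formCongr_frame L H dV g hg) v).symm u)) =
    X ((localPiSplitEquiv (IsCMField.complexConj L) (Matrix.reindex e₁ e₁ (Matrix.diagonal dV ⊗ₖ JW)) hc1 hJh w hw hJw).symm
      (UnitaryGroup.reindexGL e₁ (kroneckerGL
        ((Matrix.GeneralLinearGroup.map (algebraMap L (w.1.adicCompletion L)) g)⁻¹ *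
            (u : LocalGLPi L 3 v) w * ((Matrix.GeneralLinearGroup.map (algebraMap L (w.1.adicCompletion L)) g)⁻¹)⁻¹, 1))))
  rw [inv_inv, ← localPiSplitEquiv_localLineInl_localCongr_symm L H dV g hg e₁ JW v w hw hc1 hJh hJw u,
    ContinuousMulEquiv.symm_apply_apply]

/-! ## §3 For `n' = 3` the twist `Θ_w` is inner -/

/-- **for `n' = 3`, `Θ_w` is INNER**: `a ↦ reindexGL e ((h⁻¹ a h) ⊗ 1)` is `Ad(P h⁻¹)` for the permutation matrix `P` of `e : Fin 3 × Fin 1 ≃ Fin 3`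
(`reindex e (a ⊗ 1) = P a P⁻¹`, Mathlib `PEquiv.toMatrix_toPEquiv_mul` ∕ `mul_toMatrix_toPEquiv`). [cite: BushnellHenniart2006, §1.1] -/
theorem exists_theta_eq_conj {K : Type*} [CommRing K] (e : Fin 3 × Fin 1 ≃ Fin 3) (h : GL (Fin 3) K) :
    ∃ Q : GL (Fin 3) K,
      ((UnitaryGroup.reindexGL (S := K) e).comp (kroneckerGL.comp ((MonoidHom.id (GL (Fin 3) K)).prod 1))).comp
          (MulAut.conj h⁻¹).toMonoidHom = (MulAut.conj Q).toMonoidHom := by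
  classical
  -- the permutation matrix of `e`
  let τ : Equiv.Perm (Fin 3) := e.symm.trans (Equiv.prodUnique (Fin 3) (Fin 1))
  have hPQ : τ.toPEquiv.toMatrix * τ.symm.toPEquiv.toMatrix = (1 : Matrix (Fin 3) (Fin 3) K) := by
    rw [← PEquiv.toMatrix_trans, ← Equiv.toPEquiv_trans, Equiv.self_trans_symm, Equiv.toPEquiv_refl, PEquiv.toMatrix_refl]
  have hQP : τ.symm.toPEquiv.toMatrix * τ.toPEquiv.toMatrix = (1 : Matrix (Fin 3) (Fin 3) K) := by
    rw [← PEquiv.toMatrix_trans, ← Equiv.toPEquiv_trans, Equiv.symm_trans_self, Equiv.toPEquiv_refl, PEquiv.toMatrix_refl]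
  let P : GL (Fin 3) K := ⟨τ.toPEquiv.toMatrix, τ.symm.toPEquiv.toMatrix, hPQ, hQP⟩
  have hP : ∀ a : GL (Fin 3) K, UnitaryGroup.reindexGL (S := K) e (kroneckerGL (a, 1)) = P * a * P⁻¹ := by
    intro a
    refine Units.ext ?_
    rw [UnitaryGroup.coe_reindexGL, coe_kroneckerGL, Units.val_one, Units.val_mul, Units.val_mul,
      show ((P⁻¹ : GL (Fin 3) K) : Matrix (Fin 3) (Fin 3) K) = τ.symm.toPEquiv.toMatrix from rfl,
      show ((P : GL (Fin 3) K) : Matrix (Fin 3) (Fin 3) K) = τ.toPEquiv.toMatrix from rfl,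
      Matrix.mul_assoc, PEquiv.mul_toMatrix_toPEquiv, PEquiv.toMatrix_toPEquiv_mul, Matrix.submatrix_submatrix, Equiv.symm_symm]
    ext i j
    rw [Matrix.reindex_apply, Matrix.submatrix_apply, Matrix.submatrix_apply, Matrix.kroneckerMap_apply,
      show (1 : Matrix (Fin 1) (Fin 1) K) (e.symm i).2 (e.symm j).2 = 1 from by
        rw [Subsingleton.elim (e.symm i).2 (e.symm j).2, Matrix.one_apply_eq], mul_one]
    rfl
  refine ⟨P * h⁻¹, MonoidHom.ext fun a => ?_⟩
  simp only [MonoidHom.comp_apply, MulEquiv.coe_toMonoidHom, MulAut.conj_apply, MonoidHom.prod_apply, MonoidHom.id_apply,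
    MonoidHom.one_apply, hP, mul_inv_rev, inv_inv, mul_assoc]

/-! ## §4 Generic: equivalences pulled back along homomorphisms; inner twists -/

/-- **pull back an equivalence of representations along a homomorphism `φ : G' →* G`** (the same linear map). [cite: BushnellHenniart2006, §1.1] -/
theorem nonempty_equiv_comp {k G G' V W : Type*} [CommRing k] [Group G] [Group G'] [AddCommGroup V] [Module k V] [AddCommGroup W] [Module k W]
    {ρ : Representation k G V} {σ : Representation k G W} (E : ρ.Equiv σ) (φ : G' →* G) :
    Nonempty (Representation.Equiv (show Representation k G' V from ρ.comp φ) (show Representation k G' W from σ.comp φ)) :=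
  ⟨Representation.Equiv.mk E.toLinearEquiv fun g => by
    apply LinearMap.ext
    intro v
    exact Representation.IntertwiningMap.isIntertwining _ _ E.toIntertwiningMap (φ g) v⟩

/-- **inner twist: `ρ ∘ Ad(h) ≃ ρ`**, the intertwiner being `ρ(h⁻¹)`. [cite: BushnellHenniart2006, §1.1] -/
theorem nonempty_equiv_comp_conj {k G V : Type*} [CommRing k] [Group G] [AddCommGroup V] [Module k V]
    (ρ : Representation k G V) (h : G) :
    Nonempty (Representation.Equiv (show Representation k G V from ρ.comp (MulAut.conj h).toMonoidHom) ρ) :=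
  ⟨Representation.Equiv.mk (LinearMap.GeneralLinearGroup.toLinearEquiv (ρ.asGroupHom h⁻¹)) (by
    intro g
    apply LinearMap.ext
    intro v
    change ρ h⁻¹ (ρ (h * g * h⁻¹) v) = ρ g (ρ h⁻¹ v)
    rw [← Module.End.mul_apply, ← map_mul, ← Module.End.mul_apply, ← map_mul]
    congr 1
    group)⟩

/-- ★ `Liu2021.AreIsomorphicRep` (an intertwining linear equivalence) repackaged as a Mathlib `Representation.Equiv`. [cite: BushnellHenniart2006, §1.1] -/
theorem nonempty_equiv_of_areIsomorphicRep {G V₁ V₂ : Type*} [Group G] [AddCommGroup V₁] [Module ℂ V₁] [AddCommGroup V₂] [Module ℂ V₂]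
    {ρ₁ : Representation ℂ G V₁} {ρ₂ : Representation ℂ G V₂} (h : Liu2021.AreIsomorphicRep ρ₁ ρ₂) : Nonempty (ρ₁.Equiv ρ₂) := by
  obtain ⟨f, hf⟩ := h
  exact ⟨Representation.Equiv.mk f fun g => LinearMap.ext fun v => hf g v⟩

/-! ## §5 The transported local theta type is the pulled-back model -/

/-- **THE TRANSPORTED LOCAL THETA TYPE IS THE PULLED-BACK MODEL** (`n' = 3`): if `X ∘ (localPiSplitEquiv J)⁻¹ ≃ I` as representations of `GL₃(L_w)`
(★ `AreIsomorphicRep`; e.g. ★ `Liu2021.splitPlace_chiCoinv_iso_parabolicIndGL_localSplittingCM`, p816652, at Liu's `χ_W`-coinvariants), then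
`X ∘ localLineInl ∘ κ_v⁻¹ ≃ I ∘ localPiSplitEquiv H` as representations of `U(H)(L⁺_v)`: §2 rewrites the left side as `((X ∘ (localPiSplitEquiv J)⁻¹) ∘ Ad Q) ∘
localPiSplitEquiv H` (§3), the given equivalence pulls back along `Ad Q ∘ localPiSplitEquiv H`, and `I ∘ Ad Q ≃ I` (§4).
[cite: Rogawski1990, Lemma 4.13.1 (b), §14.2 p. 232] [cite: GelbartRogawski1991, (5.1.1) p. 465, §3.2 p. 457] [cite: BushnellHenniart2006, §1.1] -/
theorem nonempty_equiv_comp_localLineInl_localCongr_symm (e₁ : Fin 3 × Fin 1 ≃ Fin 3) (JW : Matrix (Fin 1) (Fin 1) L)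
    (v : HeightOneSpectrum (𝓞 ↥(maximalRealSubfield L))) (w : PlacesOver L v)
    (hw : IsCMField.complexConj L • w.1 ≠ w.1) (hc1 : IsCMField.complexConj L ≠ 1)
    (hHh : (H.map (IsCMField.complexConj L))ᵀ = H) (hHw : IsUnit (placeForm H w.1))
    (hJh : ((Matrix.reindex e₁ e₁ (Matrix.diagonal dV ⊗ₖ JW)).map (IsCMField.complexConj L))ᵀ =
      Matrix.reindex e₁ e₁ (Matrix.diagonal dV ⊗ₖ JW))
    (hJw : IsUnit (placeForm (Matrix.reindex e₁ e₁ (Matrix.diagonal dV ⊗ₖ JW)) w.1))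
    {V : Type*} [AddCommGroup V] [Module ℂ V]
    (X : Representation ℂ (localPi L (IsCMField.complexConj L) 3 (Matrix.reindex e₁ e₁ (Matrix.diagonal dV ⊗ₖ JW)) v) V)
    {W' : Type*} [AddCommGroup W'] [Module ℂ W'] (I : Representation ℂ (GL (Fin 3) (w.1.adicCompletion L)) W')
    (hXI : Liu2021.AreIsomorphicRep
      (show Representation ℂ (GL (Fin 3) (w.1.adicCompletion L)) V from
        X.comp (localPiSplitEquiv (IsCMField.complexConj L) (Matrix.reindex e₁ e₁ (Matrix.diagonal dV ⊗ₖ JW)) hc1 hJh w hw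
          hJw).symm.toMonoidHom) I) :
    Nonempty (Representation.Equiv
      (show Representation ℂ (localPi L (IsCMField.complexConj L) 3 H v) V from
        (X.comp (localLineInl L (IsCMField.complexConj L) 3 e₁ (Matrix.diagonal dV) JW v)).comp
          (localCongr L (IsCMField.complexConj L) g one_ne_zero
            (Summit.HodgeConjecture.HodgeConjecture.Cruxes.H413.F0P2cOmegaLocalType.formCongr_frame L H dV g hg) v).symm.toMonoidHom)
      (show Representation ℂ (localPi L (IsCMField.complexConj L) 3 H v) W' from
        I.comp (localPiSplitEquiv (IsCMField.complexConj L) H hc1 hHh w hw hHw).toMonoidHom)) := by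
  obtain ⟨Q, hQ⟩ := exists_theta_eq_conj e₁ (Matrix.GeneralLinearGroup.map (algebraMap L (w.1.adicCompletion L)) g)
  have hfac := comp_localLineInl_comp_localCongr_symm_eq L H dV g hg e₁ JW v w hw hc1 hHh hHw hJh hJw X
  rw [hQ] at hfac
  obtain ⟨E⟩ := nonempty_equiv_of_areIsomorphicRep hXI
  -- `X∘inl∘κ⁻¹ = ((X∘(lPSE J)⁻¹) ∘ Ad Q) ∘ lPSE H ≃ (I ∘ Ad Q) ∘ lPSE H ≃ I ∘ lPSE H`
  rw [hfac]
  obtain ⟨E₁⟩ := nonempty_equiv_comp E (MulAut.conj Q).toMonoidHom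
  obtain ⟨E₂⟩ := nonempty_equiv_comp E₁ (localPiSplitEquiv (IsCMField.complexConj L) H hc1 hHh w hw hHw).toMonoidHom
  obtain ⟨E₃⟩ := nonempty_equiv_comp_conj I Q
  obtain ⟨E₄⟩ := nonempty_equiv_comp E₃ (localPiSplitEquiv (IsCMField.complexConj L) H hc1 hHh w hw hHw).toMonoidHom
  exact ⟨E₂.trans E₄⟩

end Summit.HodgeConjecture.HodgeConjecture.Cruxes.H413.F0P2iGRDSplitTransport

end
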